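import Summits.Ventures.CertifiedManyBodySolver.Certificates.HubbardChain_n1_ksdn_chi12nszb_n48_rows457_458
import Summits.Ventures.CertifiedManyBodySolver.Certificates.HubbardChain_n1_ksdn_U16_rows436_457_raw
import Summits.Ventures.CertifiedManyBodySolver.Certificates.HubbardChain_n1_ksdn_U12_rows437_458_raw
import HarnessLib
import HarnessLib.Audit

/-!
# Ventures/CertifiedManyBodySolver — Certificates/HubbardChain_n1_ksdn_U16U12_rows457_458_raw_window.lean: the `…_of_window` direction for
# CERTIFIED #457 (16, 1) / #458 (12, 1)

HONEST FRAMING: first certified bounds; not a superconductivity verdict; every number certified or labelled float.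

Speedrun cell sr-mbsolver / programme hubbard-alg, LIT team (lit-1 gen-21 draft, filed by gen-24 once the imported window-level module was built on the farm). The BY-VALUE modules of the χ12 `nszb` rows #457 / #458
(`Certificates/HubbardChain_n1_ksdn_U16_rows436_457_raw.lean` p381776, `…_U12_rows437_458_raw.lean` p381799, lit-1 g20) were filed BEFORE the
window-level file of those two rows (`Certificates/HubbardChain_n1_ksdn_chi12nszb_n48_rows457_458.lean`, lit-4 g16 p380105) was in the tree, so — unlike
their sibling rows #436 / #437 / #405 / #443 / #430 / #355 / #381 / #399 — they carry no `ltiChainKSDNNodeSrotNszb_rN_of_window` theorem. This file adds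
exactly those two theorems and nothing else: the window-level claim node `cert_r457_… := LTIChainKSDNNodeSrot 16 45 1 lo` (resp. `cert_r458_… :=
LTIChainKSDNNodeSrot 12 45 1 lo`), which quantifies over window variables with the OCCUPATION sectors only, implies the window node WITH the staggered
row `LTIChainKSDNNodeSrotNszb U 45 1 lo` that the by-value edges `ltiChainKSDNNodeSrotNszb_r457_of_raw` / `…_r458_of_raw` reach (an extra hypothesis is
dropped: `LTIChainKSDNNodeSrot.nszb`, `Rows/HubbardChainMPSRaw6TrNodesNszb.lean`) — the direction that holds between the two levels; both give the SAME
standard node `LTIChainKSDNNode U 45 1 lo` and the SAME M1 rows. No number, no new node, no `sorry`, no new axiom, 0 facts.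
[cite: KullEtAl2024, §3.3, §4.2]
-/

noncomputable section

open Summit.Ventures.CertifiedManyBodySolver

namespace Summit.Ventures.CertifiedManyBodySolver.Certificates

/-- The window-level claim node of CERTIFIED #457 (`cert_r457_ksdn_hubrotU16_chi12nszbc_n48 := LTIChainKSDNNodeSrot 16 45 1 (-46960219805/2³⁸)`,
lit-4 p380105) implies the `nszb` window node reached by the by-value edge `ltiChainKSDNNodeSrotNszb_r457_of_raw` (p381776): occupation sectors ⊆
occupation + staggered sectors (`LTIChainKSDNNodeSrot.nszb`). -/
theorem ltiChainKSDNNodeSrotNszb_r457_of_window (h : cert_r457_ksdn_hubrotU16_chi12nszbc_n48) :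
    LTIChainKSDNNodeSrotNszb 16 45 1 (-46960219805/274877906944) :=
  LTIChainKSDNNodeSrot.nszb h

/-- The window-level claim node of CERTIFIED #458 (`cert_r458_ksdn_hubrotU12_chi12nszb_n48 := LTIChainKSDNNodeSrot 12 45 1 (-123824462087/2³⁹)`,
lit-4 p380105) implies the `nszb` window node reached by the by-value edge `ltiChainKSDNNodeSrotNszb_r458_of_raw` (p381799). -/
theorem ltiChainKSDNNodeSrotNszb_r458_of_window (h : cert_r458_ksdn_hubrotU12_chi12nszb_n48) :
    LTIChainKSDNNodeSrotNszb 12 45 1 (-123824462087/549755813888) :=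
  LTIChainKSDNNodeSrot.nszb h

end Summit.Ventures.CertifiedManyBodySolver.Certificates

end
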